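import Literature.Topology.FourManifolds.BordismFourNullBordism
import HarnessLib

/-!
# `M ⊔ M̄` bounds: Kirby's Cor. IX.2 for the manifolds `M ⊔ M̄`, and Thom's dictionary as an equivalence
(proof file for `Literature.Topology.FourManifolds.isOrientedBordant_of_isEmpty_of_signature_eq_zero`)

Second sibling proof file (after `BordismFourNullBordism.lean`) of the fact seat
`provefact-Literature.Topology.FourManifolds.isOrientedBordant_of_isEmpty_of_signature_eq_zero`
(R. Kirby, *The topology of 4-manifolds*, LNM 1374 (1989), Cor. IX.2: a closed oriented smooth
4-manifold of signature zero is an oriented boundary; `ker (τ : Ω⁴ → ℤ) = 0`, R. Thom, Comment.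
Math. Helv. 28 (1954), Thm IV.13).  `BordismFourNullBordism.lean` proved one direction of Thom's
dictionary (a null-bordism of `M ⊔ N̄` is a two-ended oriented bordism `(M, μ) ∼ (N, ν)`) and
oriented reflexivity (the cylinder).  Here:

* §1 `isImmersionAtOfComplement_sumElim_inl/inr`, `finrank_complement_of_isImmersionAtOfComplement`,
  `isImmersion_sumElim`, `isSmoothEmbedding_sumElim` — **a smooth-embedding criterion for
  `f ⊔ g : M ⊔ M' → W`** (Lee 2013, Prop. 4.22(c), Ch. 5): immersion pointwise by locality
  (precompose with the partial inverse of the open embedding `inl`/`inr`, the tree's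
  `IsImmersionAtOfComplement.comp_openPartialHomeomorph`); Mathlib's `IsImmersion` fixes ONE
  complement `F` for all points, and the complements of `f` and `g` are identified by the
  dimension count `dim F = dim E' − k` (`ContinuousLinearEquiv.ofFinrankEq`); embedding by
  compactness (`Continuous.isClosedEmbedding`, `IsClosedEmbedding.sumElim`).
* §2 `IsCobordant.sum_of_isEmpty`, `IsOrientedBordant.sum_of_isEmpty` — **the converse
  dictionary** (Milnor's two-ended cobordism `∂W = M ⊔ N`, 1965 §1 ⟹ Thom's "`V' − V` est une
  variété-bord", 1954 Ch. IV §1 p. 64; Milnor–Stasheff 1974 §17 p. 200): `(M, μ) ∼ (N, ν)`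
  through `(W, w)` gives the null-bordism `(W, w)` of `(M ⊔ N, μ ⊔ −ν)` with incoming end
  `inl ⊔ inr`; hence the equivalences `isOrientedBordant_iff_sum_of_isEmpty`,
  `isCobordant_iff_sum_of_isEmpty`.
* §3 `isOrientedBordant_sum_neg_self` — **`(M ⊔ M, μ ⊔ −μ)` is an oriented boundary** for every
  closed smooth `ℤ`-oriented `n`-manifold (the cylinder `M × [0, 1]`, `isOrientedBordant_refl`,
  read through §2; Thom 1954 Ch. IV §1: `−V` is the inverse of `V` in `Ωₙ`; Milnor–Stasheff
  Lemma 17.1), and `signature_sum_neg_self` (`σ(M ⊔ M̄) = 0` in dimension 4, Thom Ch. IV §2).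
  Together: **Kirby's Cor. IX.2 holds, unconditionally, for all the signature-zero 4-manifolds
  of the form `M ⊔ M̄`** — the first non-empty instances of
  `isOrientedBordant_of_isEmpty_of_signature_eq_zero` in the tree.

Everything here is proved; no definitions, no named facts, no instances.  NOT here: the fact in
general (needs `Ω₄^SO ↪ ℤ`: immersion theory / Pontryagin–Thom, absent from Mathlib and the
tree), transitivity of oriented bordism (partial-boundary gluing, the tree's open
`IsCobordant.trans`), and the connected-sum cobordism `M₁ ⊔ M₂ ∼ M₁ # M₂`.

## References

* R. Kirby, *The topology of 4-manifolds*, LNM 1374, Springer 1989, Ch. IX Cor. 2. [Kirby1989]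
* R. Thom, Comment. Math. Helv. 28 (1954), Ch. IV §1 (p. 64), §2 (p. 65), Thm IV.13 (p. 81).
  [ThomCMH1954]
* J. Milnor, J. Stasheff, *Characteristic classes* (1974), §17, p. 200, Lemma 17.1.
  [MilnorStasheffAMS76]
* J. Milnor, *Lectures on the h-cobordism theorem* (1965), §1. [Milnor1965]
* J. M. Lee, *Introduction to Smooth Manifolds*, 2nd ed. (2013), Prop. 4.22, Ch. 5.
  [LeeSmoothManifolds2013]
-/

noncomputable section

open scoped Manifold ContDiff Topology
open Set Function _root_.Topology Literature.AlgebraicTopology.SingularHomology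
open Literature.AlgebraicTopology.SingularHomology.SingularSimplex (sumInl sumInr)

universe u

namespace Literature.Topology.FourManifolds

/-! ### §1 A smooth-embedding criterion for `Sum.elim` -/

section SumElim

variable {E' : Type u} [NormedAddCommGroup E'] [NormedSpace ℝ E'] {G : Type*} [TopologicalSpace G]
  {J : ModelWithCorners ℝ E' G} {k : ℕ}
  {M M' : Type*} [TopologicalSpace M] [ChartedSpace (EuclideanSpace ℝ (Fin k)) M]
  [TopologicalSpace M'] [ChartedSpace (EuclideanSpace ℝ (Fin k)) M']
  [IsManifold (𝓡 k) ∞ M] [IsManifold (𝓡 k) ∞ M']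
  {W : Type*} [TopologicalSpace W] [ChartedSpace G W]
  {F : Type*} [NormedAddCommGroup F] [NormedSpace ℝ F]

/-- **`f ⊔ g` is an immersion at `inl x` if `f` is an immersion at `x`** (same complement): the
partial inverse of the open embedding `inl : M → M ⊔ M'` is a partial diffeomorphism `M ⊔ M' ⇀ M`
defined near `inl x`, and `(f ∘ inl⁻¹)` agrees with `f ⊔ g` near `inl x` (Lee 2013, Ch. 4:
being an immersion is local). [folklore] -/
theorem isImmersionAtOfComplement_sumElim_inl {f : M → W} {g : M' → W} {x : M}
    (hf : Manifold.IsImmersionAtOfComplement F (𝓡 k) J ∞ f x) :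
    Manifold.IsImmersionAtOfComplement F (𝓡 k) J ∞ (Sum.elim f g) (Sum.inl x) := by
  haveI : Nonempty M := ⟨x⟩
  set Ψ : OpenPartialHomeomorph M (M ⊕ M') :=
    (IsOpenEmbedding.inl (X := M) (Y := M')).toOpenPartialHomeomorph Sum.inl with hΨ
  have hΨapp : (Ψ : M → M ⊕ M') = Sum.inl := IsOpenEmbedding.toOpenPartialHomeomorph_apply _ _
  have hΨtgt : Ψ.target = range Sum.inl := IsOpenEmbedding.toOpenPartialHomeomorph_target _ _
  have hleft : ∀ x' : M, Ψ.symm (Sum.inl x') = x' := fun x' =>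
    IsOpenEmbedding.toOpenPartialHomeomorph_left_inv _ _
  have h1 : ContMDiffOn (𝓡 k) (𝓡 k) ∞ Ψ.symm Ψ.symm.source := by
    rw [Ψ.symm_source, hΨtgt]
    refine ((contMDiff_id.sumElim (contMDiff_const (c := x))).contMDiffOn
      (s := range Sum.inl)).congr ?_
    rintro _ ⟨x', rfl⟩
    rw [hleft]
    rfl
  have h2 : ContMDiffOn (𝓡 k) (𝓡 k) ∞ Ψ.symm.symm Ψ.symm.target := by
    rw [Ψ.symm_symm, Ψ.symm_target, hΨapp]
    exact ContMDiff.inl.contMDiffOn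
  have hx : Sum.inl x ∈ Ψ.symm.source := by
    rw [Ψ.symm_source, hΨtgt]; exact ⟨x, rfl⟩
  have hf' : Manifold.IsImmersionAtOfComplement F (𝓡 k) J ∞ f (Ψ.symm (Sum.inl x)) := by
    rw [hleft]; exact hf
  refine (hf'.comp_openPartialHomeomorph Ψ.symm h1 h2 hx).congr_of_eventuallyEq ?_
  filter_upwards [isOpen_range_inl.mem_nhds ⟨x, rfl⟩]
  rintro _ ⟨x', rfl⟩
  change f (Ψ.symm (Sum.inl x')) = f x'
  rw [hleft]

/-- **`f ⊔ g` is an immersion at `inr y` if `g` is an immersion at `y`** (same complement).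
[folklore] -/
theorem isImmersionAtOfComplement_sumElim_inr {f : M → W} {g : M' → W} {y : M'}
    (hg : Manifold.IsImmersionAtOfComplement F (𝓡 k) J ∞ g y) :
    Manifold.IsImmersionAtOfComplement F (𝓡 k) J ∞ (Sum.elim f g) (Sum.inr y) := by
  haveI : Nonempty M' := ⟨y⟩
  set Ψ : OpenPartialHomeomorph M' (M ⊕ M') :=
    (IsOpenEmbedding.inr (X := M) (Y := M')).toOpenPartialHomeomorph Sum.inr with hΨ
  have hΨapp : (Ψ : M' → M ⊕ M') = Sum.inr := IsOpenEmbedding.toOpenPartialHomeomorph_apply _ _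
  have hΨtgt : Ψ.target = range Sum.inr := IsOpenEmbedding.toOpenPartialHomeomorph_target _ _
  have hleft : ∀ y' : M', Ψ.symm (Sum.inr y') = y' := fun y' =>
    IsOpenEmbedding.toOpenPartialHomeomorph_left_inv _ _
  have h1 : ContMDiffOn (𝓡 k) (𝓡 k) ∞ Ψ.symm Ψ.symm.source := by
    rw [Ψ.symm_source, hΨtgt]
    refine (((contMDiff_const (c := y)).sumElim contMDiff_id).contMDiffOn
      (s := range Sum.inr)).congr ?_
    rintro _ ⟨y', rfl⟩
    rw [hleft]
    rfl
  have h2 : ContMDiffOn (𝓡 k) (𝓡 k) ∞ Ψ.symm.symm Ψ.symm.target := by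
    rw [Ψ.symm_symm, Ψ.symm_target, hΨapp]
    exact ContMDiff.inr.contMDiffOn
  have hy : Sum.inr y ∈ Ψ.symm.source := by
    rw [Ψ.symm_source, hΨtgt]; exact ⟨y, rfl⟩
  have hg' : Manifold.IsImmersionAtOfComplement F (𝓡 k) J ∞ g (Ψ.symm (Sum.inr y)) := by
    rw [hleft]; exact hg
  refine (hg'.comp_openPartialHomeomorph Ψ.symm h1 h2 hy).congr_of_eventuallyEq ?_
  filter_upwards [isOpen_range_inr.mem_nhds ⟨y, rfl⟩]
  rintro _ ⟨y', rfl⟩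
  change g (Ψ.symm (Sum.inr y')) = g y'
  rw [hleft]

omit [NormedAddCommGroup F] [NormedSpace ℝ F] [IsManifold (𝓡 k) ∞ M] in
/-- **The complement of an immersion between finite-dimensional manifolds has the expected
dimension**: if `f : M → W` is an immersion at `x` with complement `F` (so `ℝᵏ × F ≃L E'`), then
`F` is finite-dimensional of dimension `dim E' − k`. [folklore] -/
theorem finrank_complement_of_isImmersionAtOfComplement [FiniteDimensional ℝ E']
    {F : Type*} [NormedAddCommGroup F] [NormedSpace ℝ F] {f : M → W} {x : M}
    (hf : Manifold.IsImmersionAtOfComplement F (𝓡 k) J ∞ f x) :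
    FiniteDimensional ℝ F ∧ Module.finrank ℝ F = Module.finrank ℝ E' - k := by
  have e := hf.equiv
  haveI : FiniteDimensional ℝ (EuclideanSpace ℝ (Fin k) × F) :=
    LinearEquiv.finiteDimensional e.toLinearEquiv.symm
  haveI : FiniteDimensional ℝ F :=
    Module.Finite.of_surjective (LinearMap.snd ℝ (EuclideanSpace ℝ (Fin k)) F) Prod.snd_surjective
  refine ⟨this, ?_⟩
  have h := e.toLinearEquiv.finrank_eq
  rw [Module.finrank_prod, finrank_euclideanSpace_fin] at h
  omega

/-- **`f ⊔ g : M ⊔ M' → W` is an immersion if `f` and `g` are** (finite-dimensional target).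
Mathlib's `IsImmersion` fixes one complement `F` for all points; the complements of `f` and `g`
are identified by a dimension count (`finrank_complement_of_isImmersionAtOfComplement`,
`IsImmersionAtOfComplement.congr_F`). [folklore] -/
theorem isImmersion_sumElim [FiniteDimensional ℝ E'] {f : M → W} {g : M' → W}
    (hf : Manifold.IsImmersion (𝓡 k) J ∞ f) (hg : Manifold.IsImmersion (𝓡 k) J ∞ g) :
    Manifold.IsImmersion (𝓡 k) J ∞ (Sum.elim f g) := by
  obtain ⟨F₁, _, _, hf⟩ := hf
  obtain ⟨F₂, _, _, hg⟩ := hg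
  rcases isEmpty_or_nonempty M with hM | ⟨⟨x₀⟩⟩
  · exact ⟨F₂, inferInstance, inferInstance, fun p => match p with
      | Sum.inl x => isEmptyElim x
      | Sum.inr y => isImmersionAtOfComplement_sumElim_inr (hg y)⟩
  rcases isEmpty_or_nonempty M' with hM' | ⟨⟨y₀⟩⟩
  · exact ⟨F₁, inferInstance, inferInstance, fun p => match p with
      | Sum.inl x => isImmersionAtOfComplement_sumElim_inl (hf x)
      | Sum.inr y => isEmptyElim y⟩
  -- both summands are inhabited: identify the two complements by their dimension
  obtain ⟨_, h₁⟩ := finrank_complement_of_isImmersionAtOfComplement (hf x₀)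
  obtain ⟨_, h₂⟩ := finrank_complement_of_isImmersionAtOfComplement (hg y₀)
  have e : F₂ ≃L[ℝ] F₁ := ContinuousLinearEquiv.ofFinrankEq (h₂.trans h₁.symm)
  exact ⟨F₁, inferInstance, inferInstance, fun p => match p with
    | Sum.inl x => isImmersionAtOfComplement_sumElim_inl (hf x)
    | Sum.inr y => (isImmersionAtOfComplement_sumElim_inr (hg y)).trans_F e⟩

/-- **Smooth-embedding criterion for `f ⊔ g`**: if `f : M → W` and `g : M' → W` are smooth
embeddings of compact manifolds into a Hausdorff (finite-dimensional) manifold with disjoint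
images, then `f ⊔ g : M ⊔ M' → W` is a smooth embedding (immersion: `isImmersion_sumElim`;
embedding: a continuous injection of a compact space into a Hausdorff space is a closed
embedding, and `IsClosedEmbedding.sumElim`).  Lee 2013, Prop. 4.22(c), Ch. 5. [folklore] -/
theorem isSmoothEmbedding_sumElim [FiniteDimensional ℝ E'] [CompactSpace M] [CompactSpace M']
    [T2Space W] {f : M → W} {g : M' → W}
    (hf : Manifold.IsSmoothEmbedding (𝓡 k) J ∞ f) (hg : Manifold.IsSmoothEmbedding (𝓡 k) J ∞ g)
    (hfg : Disjoint (range f) (range g)) :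
    Manifold.IsSmoothEmbedding (𝓡 k) J ∞ (Sum.elim f g) := by
  refine ⟨isImmersion_sumElim hf.isImmersion hg.isImmersion, ?_⟩
  have hinj : Injective (Sum.elim f g) :=
    hf.isEmbedding.injective.sumElim hg.isEmbedding.injective fun a b hab =>
      disjoint_left.1 hfg ⟨a, rfl⟩ ⟨b, hab.symm⟩
  exact ((hf.isEmbedding.continuous.isClosedEmbedding hf.isEmbedding.injective).sumElim
    (hg.isEmbedding.continuous.isClosedEmbedding hg.isEmbedding.injective) hinj).isEmbedding

end SumElim


/-! ### §2 The converse dictionary: two ends ⟹ `M ⊔ N̄` bounds -/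

section Converse

variable {n : ℕ} {M N E : Type u} [TopologicalSpace M] [ChartedSpace (EuclideanSpace ℝ (Fin n)) M]
  [TopologicalSpace N] [ChartedSpace (EuclideanSpace ℝ (Fin n)) N]
  [TopologicalSpace E] [ChartedSpace (EuclideanSpace ℝ (Fin n)) E]

/-- A map out of an empty manifold is a smooth embedding (private copy of the tree's
`Literature.Topology.FourManifolds.isSmoothEmbedding_of_isEmpty`, `CobordismAttachmentProofs.lean`,
not imported here). [folklore] -/
private theorem isSmoothEmbedding_of_isEmpty_aux' [IsEmpty E] {W : Type u} [TopologicalSpace W]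
    [ChartedSpace (EuclideanHalfSpace (n + 1)) W] (f : E → W) :
    Manifold.IsSmoothEmbedding (𝓡 n) (𝓡∂ (n + 1)) ∞ f :=
  ⟨⟨PUnit, inferInstance, inferInstance, fun x => isEmptyElim x⟩, .of_subsingleton f⟩

/-- The ends of a cobordism, taken together, cover exactly the boundary:
`range (inl ⊔ inr) = ∂W`. [folklore] -/
theorem Cobordism.range_sumElim (c : Cobordism n M N) :
    range (Sum.elim c.inl c.inr) = (𝓡∂ (n + 1)).boundary c.W := by
  rw [Set.Sum.elim_range, c.range_inl_union_range_inr]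

/-- **Milnor's two-ended cobordisms ⟹ Thom's dictionary (unoriented).**  A cobordism `W` from `M`
to `N` (compact ends) is a cobordism from `M ⊔ N` to the empty manifold: same `W`, incoming end
`inl ⊔ inr` — a smooth embedding by `isSmoothEmbedding_sumElim` — and empty outgoing end
(Milnor 1965, §1, `∂W = M ⊔ N`; Thom 1954, Ch. IV §1, p. 64). [cite: ThomCMH1954, Ch. IV §1 p. 64] -/
theorem IsCobordant.sum_of_isEmpty [IsManifold (𝓡 n) ∞ M] [IsManifold (𝓡 n) ∞ N] [CompactSpace M]
    [CompactSpace N] [IsEmpty E] (h : IsCobordant n M N) : IsCobordant n (M ⊕ N) E := by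
  obtain ⟨c⟩ := h
  exact ⟨{ W := c.W
           inl := Sum.elim c.inl c.inr
           inr := fun e => isEmptyElim e
           isSmoothEmbedding_inl :=
             isSmoothEmbedding_sumElim c.isSmoothEmbedding_inl c.isSmoothEmbedding_inr
               c.disjoint_range
           isSmoothEmbedding_inr := isSmoothEmbedding_of_isEmpty_aux' _
           disjoint_range := by
             rw [range_eq_empty fun e : E => (isEmptyElim e : c.W)]
             exact disjoint_empty _
           range_inl_union_range_inr := by
             rw [range_eq_empty fun e : E => (isEmptyElim e : c.W), union_empty,
               c.range_sumElim] }⟩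

/-- **Milnor's two-ended oriented bordisms ⟹ Thom's dictionary.**  If `(M, μ) ∼ (N, ν)` through
`(W, w)`, `∂w = (inl)_*[M]_μ − (inr)_*[N]_ν`, then `(M ⊔ N, μ ⊔ (−ν))` is an oriented boundary:
the same `(W, w)` read as a cobordism from `M ⊔ N` to `∅` (as in
`IsCobordant.sum_of_isEmpty`) has `∂w = (inl ⊔ inr)_*[M ⊔ N]_{μ ⊔ −ν}`, because `[M ⊔ N]_{μ ⊔ −ν} = (ι_M)_*[M]_μ − (ι_N)_*[N]_ν`
(`fundamentalClass_sum`, `fundamentalClass_neg_holds`).  Thom 1954, Ch. IV §1, p. 64 ("`V ≃ V'`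
si `V' − V` est une variété-bord"); Milnor–Stasheff 1974, §17 p. 200. [cite: ThomCMH1954, Ch. IV §1 p. 64] -/
theorem IsOrientedBordant.sum_of_isEmpty [IsManifold (𝓡 n) ∞ M] [IsManifold (𝓡 n) ∞ N]
    [CompactSpace M] [T2Space M] [CompactSpace N] [T2Space N] [IsEmpty E]
    {μ : HomologicalOrientation ℤ M n} {ν : HomologicalOrientation ℤ N n}
    {ξ : HomologicalOrientation ℤ (M ⊕ N) n}
    (h₁ : ∀ x, ξ.localClass (Sum.inl x) =
      relativeSingularHomology.map ℤ ℤ (sumInl M N) (mapsTo_inl_compl_singleton x) n (μ.localClass x))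
    (h₂ : ∀ y, ξ.localClass (Sum.inr y) =
      relativeSingularHomology.map ℤ ℤ (sumInr M N) (mapsTo_inr_compl_singleton y) n
        ((-ν).localClass y))
    (ε : HomologicalOrientation ℤ E n) (h : IsOrientedBordant n μ ν) :
    IsOrientedBordant n ξ ε := by
  obtain ⟨c, w, hw⟩ := h
  -- the incoming end `inl ⊔ inr : M ⊔ N → ∂W` of `W` read as a null-cobordism of `M ⊔ N`
  set j : C(M ⊕ N, ↥((𝓡∂ (n + 1)).boundary c.W)) :=
    ⟨fun p => ⟨Sum.elim c.inl c.inr p, c.range_sumElim ▸ mem_range_self p⟩,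
      (c.continuous_inl.sumElim c.continuous_inr).subtype_mk _⟩ with hj
  have hjl : j.comp (sumInl M N) = c.inlBoundary := ContinuousMap.ext fun _ => rfl
  have hjr : j.comp (sumInr M N) = c.inrBoundary := ContinuousMap.ext fun _ => rfl
  refine ⟨{ W := c.W
            inl := Sum.elim c.inl c.inr
            inr := fun e => isEmptyElim e
            isSmoothEmbedding_inl :=
              isSmoothEmbedding_sumElim c.isSmoothEmbedding_inl c.isSmoothEmbedding_inr
                c.disjoint_range
            isSmoothEmbedding_inr := isSmoothEmbedding_of_isEmpty_aux' _
            disjoint_range := by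
              rw [range_eq_empty fun e : E => (isEmptyElim e : c.W)]
              exact disjoint_empty _
            range_inl_union_range_inr := by
              rw [range_eq_empty fun e : E => (isEmptyElim e : c.W), union_empty,
                c.range_sumElim] }, w, hw.trans ?_⟩
  -- the ends of the new cobordism, read in `∂W` (`W` is unchanged)
  show _ = singularHomology.map ℤ ℤ j n ξ.fundamentalClass -
    singularHomology.map ℤ ℤ _ n ε.fundamentalClass
  rw [ε.fundamentalClass_eq_zero_of_isEmpty, map_zero, sub_zero,
    HomologicalOrientation.fundamentalClass_sum ℤ μ (-ν) ξ h₁ h₂,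
    HomologicalOrientation.fundamentalClass_neg_holds (R := ℤ) (X := N) n ν, map_neg, map_add,
    map_neg, ← sub_eq_add_neg, ← ModuleCat.comp_apply, ← ModuleCat.comp_apply,
    ← singularHomology.map_comp, ← singularHomology.map_comp, hjl, hjr]

/-- **Thom's dictionary is an equivalence**: `(M, μ) ∼ (N, ν)` (Milnor's two-ended oriented
cobordisms, the tree's `IsOrientedBordant n μ ν`) **iff** `(M ⊔ N, μ ⊔ (−ν))` is an oriented
boundary (Thom 1954, Ch. IV §1, p. 64, the definition of `Ωₙ`; Milnor–Stasheff 1974, §17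
p. 200) — `IsOrientedBordant.sum_of_isEmpty` and `IsOrientedBordant.of_sum_of_isEmpty`
(`BordismFourNullBordism.lean`). [cite: ThomCMH1954, Ch. IV §1 p. 64] -/
theorem isOrientedBordant_iff_sum_of_isEmpty [IsManifold (𝓡 n) ∞ M] [IsManifold (𝓡 n) ∞ N]
    [CompactSpace M] [T2Space M] [CompactSpace N] [T2Space N] [IsEmpty E]
    {μ : HomologicalOrientation ℤ M n} {ν : HomologicalOrientation ℤ N n}
    {ξ : HomologicalOrientation ℤ (M ⊕ N) n}
    (h₁ : ∀ x, ξ.localClass (Sum.inl x) =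
      relativeSingularHomology.map ℤ ℤ (sumInl M N) (mapsTo_inl_compl_singleton x) n (μ.localClass x))
    (h₂ : ∀ y, ξ.localClass (Sum.inr y) =
      relativeSingularHomology.map ℤ ℤ (sumInr M N) (mapsTo_inr_compl_singleton y) n
        ((-ν).localClass y))
    (ε : HomologicalOrientation ℤ E n) :
    IsOrientedBordant n μ ν ↔ IsOrientedBordant n ξ ε :=
  ⟨IsOrientedBordant.sum_of_isEmpty h₁ h₂ ε, IsOrientedBordant.of_sum_of_isEmpty h₁ h₂⟩

/-- Unoriented form of the dictionary: `M`, `N` cobordant iff `M ⊔ N` bounds (Thom 1954,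
Ch. IV §1). [cite: ThomCMH1954, Ch. IV §1 p. 64] -/
theorem isCobordant_iff_sum_of_isEmpty [IsManifold (𝓡 n) ∞ M] [IsManifold (𝓡 n) ∞ N]
    [CompactSpace M] [CompactSpace N] [IsEmpty E] :
    IsCobordant n M N ↔ IsCobordant n (M ⊕ N) E :=
  ⟨IsCobordant.sum_of_isEmpty, IsCobordant.of_sum_of_isEmpty⟩


/-! ### §3 `M ⊔ M̄` bounds: the inverse in `Ωₙ`, and Kirby's Cor. IX.2 for these manifolds -/

/-- **`M ⊔ M̄` is an oriented boundary** (Thom 1954, Ch. IV §1, p. 64: the class of `−V` is the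
inverse of the class of `V`; Milnor–Stasheff 1974, Lemma 17.1: `M + (−M)` bounds `M × [0, 1]`):
for every closed smooth `ℤ`-oriented `n`-manifold `(M, μ)`, the manifold `M ⊔ M` with the
orientation `μ ⊔ (−μ)` bounds, namely the cylinder `M × [0, 1]` read as a null-cobordism
(`isOrientedBordant_refl` and `IsOrientedBordant.sum_of_isEmpty`).  In dimension `4` these are
closed oriented 4-manifolds of signature zero (`signature_sum`, `signature_neg_holds`), so this
is **Kirby's Cor. IX.2 (`isOrientedBordant_of_isEmpty_of_signature_eq_zero`) for the manifolds
`M ⊔ M̄`**, unconditionally. [cite: ThomCMH1954, Ch. IV §1 p. 64] -/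
theorem isOrientedBordant_sum_neg_self [IsManifold (𝓡 n) ∞ M] [CompactSpace M] [T2Space M]
    [SecondCountableTopology M] [IsEmpty E]
    (μ : HomologicalOrientation ℤ M n) {ξ : HomologicalOrientation ℤ (M ⊕ M) n}
    (h₁ : ∀ x, ξ.localClass (Sum.inl x) =
      relativeSingularHomology.map ℤ ℤ (sumInl M M) (mapsTo_inl_compl_singleton x) n (μ.localClass x))
    (h₂ : ∀ y, ξ.localClass (Sum.inr y) =
      relativeSingularHomology.map ℤ ℤ (sumInr M M) (mapsTo_inr_compl_singleton y) n
        ((-μ).localClass y))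
    (ε : HomologicalOrientation ℤ E n) : IsOrientedBordant n ξ ε :=
  (isOrientedBordant_refl μ).sum_of_isEmpty h₁ h₂ ε

/-- The signature of `(M ⊔ M, μ ⊔ −μ)` vanishes (`σ(M) + σ(−M) = 0`; Thom 1954, Ch. IV §2,
p. 65). [cite: ThomCMH1954, Ch. IV §2 p. 65] -/
theorem signature_sum_neg_self {M : Type u} [TopologicalSpace M] [T2Space M]
    [ChartedSpace (EuclideanSpace ℝ (Fin 4)) M] [CompactSpace M]
    (μ : HomologicalOrientation ℤ M 4) {ξ : HomologicalOrientation ℤ (M ⊕ M) 4}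
    (h₁ : ∀ x, ξ.localClass (Sum.inl x) =
      relativeSingularHomology.map ℤ ℤ (sumInl M M) (mapsTo_inl_compl_singleton x) 4 (μ.localClass x))
    (h₂ : ∀ y, ξ.localClass (Sum.inr y) =
      relativeSingularHomology.map ℤ ℤ (sumInr M M) (mapsTo_inr_compl_singleton y) 4
        ((-μ).localClass y)) :
    ξ.signature = 0 := by
  rw [HomologicalOrientation.signature_sum μ (-μ) ξ h₁ h₂,
    HomologicalOrientation.signature_neg_holds μ, add_neg_cancel]

end Converse

end Literature.Topology.FourManifolds

end
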